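import Literature.Computability.MetaComplexity.ParityDNF
import Literature.Computability.MetaComplexity.DepthFregeLocalChain
import Literature.Computability.Complexity.StockmeyerEstimator
import Mathlib.Data.ZMod.Basic
import HarnessLib

/-!
# Hierarchical parity formulas (divide-and-conquer representation of parities in bounded depth)

Groundwork for the DEPTH-DEPENDENT bounded-depth Frege upper bound for linear algebra over `𝔽₂`
(`DepthFregeGaussianElimination.lean`: every unsatisfiable system of linear equations over `𝔽₂`
in `n ≤ a^D` variables has a `textbookFrege` refutation of its parity CNF of depth `2D + O(1)` and
size `poly(m, n) · 2^{O(D a)}` — with `a ≈ n^{1/D}`, size `2^{O(D n^{1/D})}`; the folklore upper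
bound matching Håstad's and Galesi–Itsykson–Riazanov–Sofronova's `2^{n^{Ω(1/d)}}`-type lower
bounds in shape).

The parity of a set `T` of variables is represented by a balanced formula over the `a`-ary block
hierarchy of the variable indices (block `(j, b)` = the indices `v` with `v / a^j = b`):

* `bvecs a c` — the bit vectors `Fin a → Bool` of parity `c` (bits in `𝔽₂` via `Stockmeyer.bz`);
* `hp a T j b c` — **the hierarchical parity formula** "the variables of `T` in block `(j, b)` have
  parity `c`": a literal or a constant at level `0`, and at level `j + 1` the disjunction over the
  bit vectors `cs` of parity `c` of the conjunctions `⋀_{r<a} hp a T j (b a + r) (cs r)`;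
* `eval_hp` — its semantics (`cnt`: the number of true variables of `T` in the block, mod `2`);
* `mem_vars_hp`, `size_hp_le` (`hsz a j = 2^{O(j a)}`), `dd_hp_le` (`≤ 2j + 2`): variables, size
  and disjunct depth.

References: J. Håstad, *On small-depth Frege proofs for Tseitin for grids*, J. ACM 68 (2021), §1
(the matching upper bound by divide-and-conquer parity representations); N. Galesi, D. Itsykson,
A. Riazanov, A. Sofronova, APAL 174 (2023), §4 ("compact representation of parities"). The
representation itself is folklore (the `2^{O(n^{1/(d-1)})}` depth-`d` formulas for PARITY).
-/

namespace Literature.Computability.MetaComplexity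

open Complexity Complexity.PropForm TextbookFrege Finset Complexity.Stockmeyer

namespace HierParity

/-! ### Bits and bit vectors

Bits are embedded in `𝔽₂` by `Stockmeyer.bz` (`StockmeyerEstimator.lean`: `bz_true`, `bz_false`,
`bz_xor`, `bz_injective`, `bz_decide_odd`). -/

variable (a : ℕ)

/-- The bit vectors of length `a` of parity `c`, as a list. [folklore] -/
noncomputable def bvecs (c : Bool) : List (Fin a → Bool) :=
  ((univ : Finset (Fin a → Bool)).filter fun cs => (∑ r, bz (cs r)) = bz c).toList

/-- Membership in `bvecs`. [folklore] -/
theorem mem_bvecs {c : Bool} {cs : Fin a → Bool} : cs ∈ bvecs a c ↔ (∑ r, bz (cs r)) = bz c := by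
  simp [bvecs]

/-- There are at most `2^a` bit vectors of a given parity. [folklore] -/
theorem length_bvecs_le (c : Bool) : (bvecs a c).length ≤ 2 ^ a := by
  rw [bvecs, length_toList]
  refine (card_filter_le _ _).trans ?_
  simp [card_univ]

/-! ### The hierarchical parity formula -/

/-- **The hierarchical parity formula** `hp a T j b c`: "the variables of `T` whose index lies in
block `(j, b)` (`v / a^j = b`) have parity `c`". Level `0` (a single index `b`): the literal `x_b` /
`¬x_b` if `b ∈ T`, the constant `⊥` / `⊤` otherwise; level `j + 1`: the disjunction, over the bit
vectors `cs` of parity `c`, of the conjunctions of the children's formulas `hp a T j (b a + r) (cs r)`.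
[Håstad 2021, §1; Galesi et al. 2023, §4 (compact representation of parities)] [folklore] -/
noncomputable def hp (T : Finset ℕ) : ℕ → ℕ → Bool → PropForm ℕ
  | 0, b, c => if b ∈ T then (if c then var b else neg (var b))
      else (if c then const false else const true)
  | j + 1, b, c => disjList ((bvecs a c).map fun cs =>
      conjList ((List.finRange a).map fun r : Fin a => hp T j (b * a + (r : ℕ)) (cs r)))

variable {a}

/-- Unfolding `hp` at level `0`. [folklore] -/
theorem hp_zero (T : Finset ℕ) (b : ℕ) (c : Bool) :
    hp a T 0 b c = (if b ∈ T then (if c then var b else neg (var b))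
      else (if c then const false else const true)) := rfl

/-- Unfolding `hp` at a successor level. [folklore] -/
theorem hp_succ (T : Finset ℕ) (j b : ℕ) (c : Bool) :
    hp a T (j + 1) b c = disjList ((bvecs a c).map fun cs =>
      conjList ((List.finRange a).map fun r : Fin a => hp a T j (b * a + (r : ℕ)) (cs r))) := rfl

/-! ### Semantics -/

/-- The number of true variables of `T` in block `(j, b)`. [folklore] -/
def cnt (a : ℕ) (σ : ℕ → Bool) (T : Finset ℕ) (j b : ℕ) : ℕ :=
  (T.filter fun v => v / a ^ j = b ∧ σ v = true).card

/-- `⋀M` is true iff all members are. [folklore] -/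
theorem eval_conjList (σ : ℕ → Bool) (M : List (PropForm ℕ)) :
    (conjList M).eval σ = true ↔ ∀ A ∈ M, A.eval σ = true := by
  induction M with
  | nil => simp [conjList, eval]
  | cons A M ih => simp [eval, Bool.and_eq_true, ih]

/-- Block membership one level up: `v / a^{j+1} = b` iff `v / a^j ∈ [b a, b a + a)`. [folklore] -/
theorem div_pow_succ_eq_iff (ha : 0 < a) (v j b : ℕ) :
    v / a ^ (j + 1) = b ↔ b * a ≤ v / a ^ j ∧ v / a ^ j < b * a + a := by
  rw [pow_succ, ← Nat.div_div_eq_div_mul, Nat.div_eq_iff ha]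
  constructor <;> rintro ⟨h1, h2⟩ <;> constructor <;> omega

/-- **Counting one level up**: the count of block `(j+1, b)` is the sum of the counts of its `a`
children. [folklore] -/
theorem cnt_succ (ha : 0 < a) (σ : ℕ → Bool) (T : Finset ℕ) (j b : ℕ) :
    cnt a σ T (j + 1) b = ∑ r : Fin a, cnt a σ T j (b * a + r) := by
  rw [← Finset.sum_range (fun r => cnt a σ T j (b * a + r))]
  unfold cnt
  have hmaps : Set.MapsTo (fun v => v / a ^ j)
      (↑(T.filter fun v => v / a ^ (j + 1) = b ∧ σ v = true) : Set ℕ)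
      (↑(Ico (b * a) (b * a + a)) : Set ℕ) := by
    intro v hv
    rw [mem_coe, mem_filter] at hv
    rw [mem_coe, mem_Ico]
    exact (div_pow_succ_eq_iff ha v j b).1 hv.2.1
  rw [card_eq_sum_card_fiberwise hmaps, sum_Ico_eq_sum_range]
  simp only [Nat.add_sub_cancel_left]
  refine sum_congr rfl fun r hr => ?_
  rw [mem_range] at hr
  congr 1
  ext v
  simp only [mem_filter]
  constructor
  · rintro ⟨⟨hT, -, hσ⟩, hv⟩; exact ⟨hT, hv, hσ⟩
  · rintro ⟨hT, hv, hσ⟩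
    refine ⟨⟨hT, (div_pow_succ_eq_iff ha v j b).2 ?_, hσ⟩, hv⟩
    rw [hv]; omega

/-- The count at level `0`. [folklore] -/
theorem cnt_zero (σ : ℕ → Bool) (T : Finset ℕ) (b : ℕ) :
    cnt a σ T 0 b = if b ∈ T ∧ σ b = true then 1 else 0 := by
  unfold cnt
  simp only [pow_zero, Nat.div_one]
  split_ifs with h
  · rw [card_eq_one]
    exact ⟨b, by ext v; simp only [mem_filter, mem_singleton]; constructor
      <;> [rintro ⟨-, rfl, -⟩; rintro rfl] <;> [rfl; exact ⟨h.1, rfl, h.2⟩]⟩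
  · rw [card_eq_zero, filter_eq_empty_iff]
    rintro v hv ⟨rfl, hσ⟩
    exact h ⟨hv, hσ⟩

/-- **Semantics of the hierarchical parity formula**: `hp a T j b c` is true under `σ` iff the
number of true variables of `T` in block `(j, b)` is `≡ c (mod 2)`. [folklore] -/
theorem eval_hp (ha : 0 < a) (σ : ℕ → Bool) (T : Finset ℕ) :
    ∀ (j b : ℕ) (c : Bool), (hp a T j b c).eval σ = true ↔ ((cnt a σ T j b : ℕ) : ZMod 2) = bz c := by
  intro j
  induction j with
  | zero =>
    intro b c
    rw [hp_zero, cnt_zero]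
    by_cases hb : b ∈ T
    · simp only [hb, true_and, if_true]
      cases c <;> cases hσ : σ b <;> simp [eval, hσ]
    · simp only [hb, false_and, if_false]
      cases c <;> simp [eval]
  | succ j ih =>
    intro b c
    rw [hp_succ, eval_disjList, cnt_succ ha, Nat.cast_sum]
    constructor
    · rintro ⟨A, hA, hAσ⟩
      obtain ⟨cs, hcs, rfl⟩ := List.mem_map.1 hA
      rw [eval_conjList] at hAσ
      rw [← (mem_bvecs a).1 hcs]
      refine sum_congr rfl fun r _ => ?_
      exact (ih (b * a + r) (cs r)).1 (hAσ _ (List.mem_map.2 ⟨r, List.mem_finRange r, rfl⟩))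
    · intro hsum
      set cs : Fin a → Bool := fun r => decide (Odd (cnt a σ T j (b * a + r))) with hcs
      have hbz : ∀ r, bz (cs r) = ((cnt a σ T j (b * a + r) : ℕ) : ZMod 2) := fun r => bz_decide_odd _
      have hmem : cs ∈ bvecs a c := by
        rw [mem_bvecs, ← hsum]
        exact sum_congr rfl fun r _ => hbz r
      refine ⟨_, List.mem_map.2 ⟨cs, hmem, rfl⟩, ?_⟩
      rw [eval_conjList]
      intro A hA
      obtain ⟨r, -, rfl⟩ := List.mem_map.1 hA
      exact (ih (b * a + r) (cs r)).2 (hbz r).symm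

/-! ### Counting facts: empty set, symmetric difference, the root block -/

/-- The empty set has count `0`. [folklore] -/
@[simp] theorem cnt_empty (σ : ℕ → Bool) (j b : ℕ) : cnt a σ ∅ j b = 0 := by
  simp [cnt]

/-- **Counts of a symmetric difference add up modulo `2`.** [folklore] -/
theorem cnt_symmDiff (σ : ℕ → Bool) (T T' : Finset ℕ) (j b : ℕ) :
    ((cnt a σ (symmDiff T T') j b : ℕ) : ZMod 2) = (cnt a σ T j b : ℕ) + (cnt a σ T' j b : ℕ) := by
  unfold cnt
  set P : ℕ → Prop := fun v => v / a ^ j = b ∧ σ v = true with hP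
  have hfilter : (symmDiff T T').filter P = symmDiff (T.filter P) (T'.filter P) := by
    ext v
    simp only [mem_filter, Finset.mem_symmDiff]
    tauto
  rw [hfilter]
  -- `|A ∆ B| + 2 |A ∩ B| = |A| + |B|`
  set A := T.filter P
  set B := T'.filter P
  have h1 : (symmDiff A B).card + 2 * (A ∩ B).card = A.card + B.card := by
    have hAB : symmDiff A B = (A \ B) ∪ (B \ A) := rfl
    have hdisj : Disjoint (A \ B) (B \ A) := by
      rw [Finset.disjoint_left]; intro v hv hv'
      exact (Finset.mem_sdiff.1 hv).2 (Finset.mem_sdiff.1 hv').1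
    rw [hAB, card_union_of_disjoint hdisj, card_sdiff_add_card_inter A B |>.symm,
      card_sdiff_add_card_inter B A |>.symm, inter_comm B A]
    ring
  have h2 : ((symmDiff A B).card : ZMod 2) + 2 * ((A ∩ B).card : ZMod 2) = (A.card : ZMod 2) + B.card := by
    exact_mod_cast congrArg (Nat.cast : ℕ → ZMod 2) h1
  have h20 : (2 : ZMod 2) = 0 := by decide
  rw [h20, zero_mul, add_zero] at h2
  exact h2

/-- **At the root block**: if every index of `T` is `< a^D`, the count of block `(D, 0)` is the
number of true variables of `T`. [folklore] -/
theorem cnt_root {D : ℕ} {T : Finset ℕ} (hT : ∀ v ∈ T, v < a ^ D) (σ : ℕ → Bool) :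
    cnt a σ T D 0 = (T.filter fun v => σ v = true).card := by
  unfold cnt
  congr 1
  ext v
  simp only [mem_filter]
  constructor
  · rintro ⟨hv, -, hσ⟩; exact ⟨hv, hσ⟩
  · rintro ⟨hv, hσ⟩; exact ⟨hv, Nat.div_eq_of_lt (hT v hv), hσ⟩

/-! ### Variables, size, depth -/

/-- **Variables**: `hp a T j b c` mentions only variables of `T` in block `(j, b)`. [folklore] -/
theorem mem_vars_hp (ha : 0 < a) (T : Finset ℕ) :
    ∀ (j b : ℕ) (c : Bool) {x : ℕ}, x ∈ (hp a T j b c).vars → x ∈ T ∧ x / a ^ j = b := by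
  intro j
  induction j with
  | zero =>
    intro b c x hx
    rw [hp_zero] at hx
    by_cases hb : b ∈ T
    · simp only [hb, if_true] at hx
      cases c <;> simp only [PropForm.vars, Finset.mem_singleton, Bool.false_eq_true,
        if_false, if_true] at hx <;> subst hx <;> exact ⟨hb, by simp⟩
    · simp only [hb, if_false] at hx
      cases c <;> simp [PropForm.vars] at hx
  | succ j ih =>
    intro b c x hx
    rw [hp_succ] at hx
    obtain ⟨A, hA, hx⟩ := mem_vars_disjList hx
    obtain ⟨cs, -, rfl⟩ := List.mem_map.1 hA
    obtain ⟨B, hB, hx⟩ := mem_vars_conjList hx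
    obtain ⟨r, -, rfl⟩ := List.mem_map.1 hB
    obtain ⟨hT, hdiv⟩ := ih _ _ hx
    refine ⟨hT, (div_pow_succ_eq_iff ha x j b).2 ?_⟩
    rw [hdiv]; have := r.2; omega

/-- The size budget of level `j`: `hsz a 0 = 2`, `hsz a (j+1) = 2^a (a (hsz a j + 1) + 2) + 1`.
[folklore] -/
def hsz (a : ℕ) : ℕ → ℕ
  | 0 => 2
  | j + 1 => 2 ^ a * (a * (hsz a j + 1) + 2) + 1

/-- **Size** of the hierarchical parity formula: at most `hsz a j`. [folklore] -/
theorem size_hp_le (T : Finset ℕ) : ∀ (j b : ℕ) (c : Bool), (hp a T j b c).size ≤ hsz a j := by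
  intro j
  induction j with
  | zero =>
    intro b c
    rw [hp_zero]
    split_ifs <;> simp [size, hsz]
  | succ j ih =>
    intro b c
    rw [hp_succ, size_disjList_eq_msum]
    show _ ≤ 2 ^ a * (a * (hsz a j + 1) + 2) + 1
    have hmem : ∀ X ∈ (bvecs a c).map (fun cs => conjList ((List.finRange a).map
        fun r : Fin a => hp a T j (b * a + (r : ℕ)) (cs r))), X.size + 1 ≤ a * (hsz a j + 1) + 2 := by
      intro X hX
      obtain ⟨cs, -, rfl⟩ := List.mem_map.1 hX
      rw [size_conjList_eq_msum]
      have h := msum_le_length_mul (W := hsz a j + 1)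
        (L := (List.finRange a).map fun r : Fin a => hp a T j (b * a + (r : ℕ)) (cs r)) fun Y hY => by
          obtain ⟨r, -, rfl⟩ := List.mem_map.1 hY
          exact Nat.succ_le_succ (ih _ _)
      rw [List.length_map, List.length_finRange] at h
      omega
    have h := msum_le_length_mul hmem
    rw [List.length_map] at h
    have hl := length_bvecs_le a c
    have := Nat.mul_le_mul_right (a * (hsz a j + 1) + 2) hl
    omega

/-- **Disjunct depth** of the hierarchical parity formula: at most `2j + 2`. [folklore] -/
theorem dd_hp_le (T : Finset ℕ) : ∀ (j b : ℕ) (c : Bool), (hp a T j b c).dd ≤ 2 * j + 2 := by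
  intro j
  induction j with
  | zero =>
    intro b c
    rw [hp_zero]
    split_ifs <;> simp
  | succ j ih =>
    intro b c
    rw [hp_succ]
    refine (dd_disjList_le (p := 2 * j + 4) fun X hX => ?_).trans (by omega)
    obtain ⟨cs, -, rfl⟩ := List.mem_map.1 hX
    exact dd_conjList_le fun Y hY => by
      obtain ⟨r, -, rfl⟩ := List.mem_map.1 hY
      exact ih _ _

/-- Auxiliary depths of the hierarchical parity formula: at most `2j + 3`. [folklore] -/
theorem altDepthAux_hp_le (T : Finset ℕ) (j b : ℕ) (c : Bool) (t : ℕ) :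
    altDepthAux t (hp a T j b c) ≤ 2 * j + 3 := by
  have h1 := altDepthAux_le_dd_succ t (hp a T j b c)
  have h2 := dd_hp_le T j b c (a := a)
  omega

/-- Alternation depth of the hierarchical parity formula: at most `2j + 3`. [folklore] -/
theorem altDepth_hp_le (T : Finset ℕ) (j b : ℕ) (c : Bool) : (hp a T j b c).altDepth ≤ 2 * j + 3 :=
  altDepthAux_hp_le T j b c 0

/-- `hsz` is at least `2`. [folklore] -/
theorem two_le_hsz (a j : ℕ) : 2 ≤ hsz a j := by
  cases j with
  | zero => simp [hsz]
  | succ j =>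
    show 2 ≤ 2 ^ a * (a * (hsz a j + 1) + 2) + 1
    have h1 := Nat.one_le_two_pow (n := a)
    have h2 : 1 * 2 ≤ 2 ^ a * (a * (hsz a j + 1) + 2) := Nat.mul_le_mul h1 (by omega)
    omega

end HierParity

end Literature.Computability.MetaComplexity
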